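import Summits.SmoothPoincare4.SmoothPoincare4.Theorems.DottedCircleRasmussenDcrGapHelperHandlebodyChartModelHandlesCollarAux

/-!
# Helper `helper_handlebodyChart_modelHandles` (M3: handle structure of the model dotted handlebody `D_k`)
# of line `mk_friends` for crux `DcrGap` — the assembly `helper_handlebodyChart_modelHandles_of_data`
(item stmt-SmoothPoincare4-16128, route route-SmoothPoincare4-DottedCircleRasmussen)

**M3 reduced to its analytic ingredients.**  The registered model lemma M3
(`helper_handlebodyChart_modelHandles`, the last provable debt of stub `stub_handlebodyChart`) asks for a
base ball and `k` handle charts `h j` of `D_k = MMSW.modelHandlebody k` and, for every open `U ⊇ D_k`,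
twist vector `m` and radius `a < ρ < 3a/2`, for a twist exponent `ε`, a diffeomorphism `κ` of `ℝ⁴`
supported in `U` squeezing `D_k` into `B̄(c, ρ) ∪ ⋃ⱼ h j (T)`, and a GLOBAL smooth injective immersion
`θ` of `ℝ⁴` with `θ ∘ τ^ε = σ_m ∘ κ` on `D_k` (`τ^ε` the per-handle sphere twist, `σ_m` the handle
twist `h j ∘ R_{m j} ∘ (h j)⁻¹` on tube `j`).  This file proves the registered reduction
`helper_handlebodyChart_modelHandles_of_data`: M3 follows from the registered data statement
`helper_handlebodyChart_modelHandles_data`, which asks for the static data of M3 together with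

* (equivariance) each chart `h j` intertwines the rotations of the `(p₂, p₃)`-plane of the model
  cylinder with the rotations `(z, w) ↦ (z, u w)` of the `w`-plane of `ℝ⁴ = ℂ²`;
* (phase data) for all `m`, `ρ < 3a/2`: an exponent `ε` and a smooth rotation-invariant real function
  `Θ` on a neighbourhood of `B̄(c, ρ) ∪ ⋃ⱼ h j (T)` with `e^{iΘ} u_ε(z) = 1` on the ball and
  `e^{iΘ} u_ε(z) = e^{2πi m_j χ(p₀ + 1/2)}` on tube `j` (`u_ε(z) = Π_l u(z - c_l)^{ε_l}`,
  `u(v) = v/|v|`, `χ = Real.smoothTransition`) — the winding-number bookkeeping of the cores about the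
  holes, which fixes `ε` in terms of `m`;
* (squeeze) for all open `U ⊇ D_k`, `a < ρ < 3a/2`: a diffeomorphism `κ` of `ℝ⁴`, the identity off a
  compact part of `U`, commuting with the rotations of the `w`-plane, with
  `κ(D_k) ⊆ B̄(c, ρ) ∪ ⋃ⱼ h j (T)`, and smooth invariant lifts `SW_l` near `D_k` of the angles swept
  about the holes, `u(z(κ x) - c_l) = e^{i SW_l(x)} u(z(x) - c_l)` on `D_k` (the collar push of
  `…ModelHandlesCollar.lean` is the first factor of such a `κ`).

Proof (`ModelHandles.modelHandles_dynamic_of_data`).  Put `ϑ = Θ ∘ κ + Σ_l ε_l SW_l`: smooth on a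
neighbourhood `N₁` of `D_k`, invariant under the rotations of the `w`-plane, and
`u_ε(z) e^{iϑ} = e^{iΘ(κ x)} u_ε(z(κ x)) =: P(x)` on `D_k` (the swept angles telescope the two
multipliers).  Cut `ϑ` off by an invariant smooth cutoff equal to `1` on `D_k` and supported in `N₁`
(`ModelHandles.exists_invariant_cutoff`, built from `G_k` and the hole terms), and let
`θ = κ ∘ F`, `F(z, w) = (z, w e^{iϑ})`: `F` is a smooth bijection with smooth inverse
`(z, w) ↦ (z, w e^{-iϑ})` by invariance (`ModelHandles.phaseRot_embedding`), so `θ` is a smooth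
injective immersion (`ModelHandles.diffeomorph_comp_embedding`).  For `x ∈ D_k`,
`F (τ^ε x) = (z, w P(x))` is `x` rotated by the unit `P(x)`, which `κ` carries to `κ x` rotated by `P(x)`:
on the ball `P = 1`, and on tube `j`, `P = e^{2πi m_j χ(p₀ + 1/2)}` and the rotated point is
`h j (R_{m j} p)` by equivariance — the two alternatives of M3.

No definitions, no named facts, no `sorry`.  References: R. Kirby, *The Topology of 4-Manifolds*,
LNM 1374 (1989), Ch. I §2 [Kirby1989]; M. W. Hirsch, *Differential Topology* (1976), Ch. 8 §1 [HirschDT1976].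
-/

-- the prescribed namespace `Summit.<P>.<Sub>.…` duplicates `SmoothPoincare4` (P = Sub)
set_option linter.dupNamespace false
set_option linter.style.longLine false
noncomputable section

open scoped Manifold ContDiff Topology
open Function Set Metric Filter
open Literature.Topology.FourManifolds Literature.Topology.FourManifolds.MMSW
open Literature.AlgebraicTopology.Homotopy.HopfFibration

namespace Summit.SmoothPoincare4.SmoothPoincare4.Theorems.DcrGap.MkFriends

namespace ModelHandles

/-! ## An invariant cutoff near `D_k` -/

/-- **An invariant smooth cutoff for `D_k` inside an open set**: for every open `N ⊇ D_k` a smooth `ψ`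
on `ℝ⁴`, equal to `1` on `D_k`, vanishing off a closed subset of `N`, invariant under the rotations of the
`w`-plane (`ψ = φ(G_k)` on the half-guard zone, `φ = 1` below `1 + m`, `0` above `1 + 2m`, the band
`{guard ≥ 1/2, G_k ≤ 1 + 2m}` lying in `N`, `exists_band_subset`). [folklore] -/
theorem exists_invariant_cutoff (k : ℕ) {N : Set (EuclideanSpace ℝ (Fin 4))} (hNo : IsOpen N)
    (hDN : modelHandlebody k ⊆ N) :
    ∃ (ψ : EuclideanSpace ℝ (Fin 4) → ℝ) (B : Set (EuclideanSpace ℝ (Fin 4))),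
      ContDiff ℝ ∞ ψ ∧ (∀ x ∈ modelHandlebody k, ψ x = 1) ∧ IsClosed B ∧ B ⊆ N ∧
      (∀ x, ψ x ≠ 0 → x ∈ B) ∧
      ∀ v : ℂ, ‖v‖ = 1 → ∀ x, ψ (fibreRot (fun _ => v) x) = ψ x := by
  obtain ⟨m, hm0, hm4, hmN⟩ := exists_band_subset k hNo hDN
  set φ : ℝ → ℝ := fun g => Real.smoothTransition ((1 + 2 * m - g) / m) with hφ
  have hφs : ContDiff ℝ ∞ φ :=
    Real.smoothTransition.contDiff.comp ((contDiff_const.sub contDiff_id).div_const _)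
  have hφ1 : ∀ g, g ≤ 1 + m → φ g = 1 := fun g hg =>
    Real.smoothTransition.one_of_one_le (by rw [le_div_iff₀ hm0]; linarith)
  have hφ0 : ∀ g, φ g ≠ 0 → g < 1 + 2 * m := fun g hg => by
    by_contra hle; push Not at hle
    exact hg (Real.smoothTransition.zero_of_nonpos (div_nonpos_of_nonpos_of_nonneg (by linarith) hm0.le))
  set ψ : EuclideanSpace ℝ (Fin 4) → ℝ :=
    fun y => if ∀ j : Fin k, (1 : ℝ) / 4 < holeTerm k j y then φ (levelFun k y) else 0 with hψ
  set B : Set (EuclideanSpace ℝ (Fin 4)) := {y | (∀ j : Fin k, (1 : ℝ) / 2 ≤ holeTerm k j y) ∧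
    levelFun k y ≤ 1 + 2 * m} with hB
  have hpos4 : ∀ y : EuclideanSpace ℝ (Fin 4), (∀ j, (1 : ℝ) / 4 < holeTerm k j y) →
      ∀ j, 0 < holeTerm k j y := fun y h j => lt_trans (by norm_num) (h j)
  have hψne : ∀ y, ψ y ≠ 0 → (∀ j, (1 : ℝ) / 4 < holeTerm k j y) ∧ levelFun k y < 1 + 2 * m := by
    intro y h
    simp only [hψ] at h
    split_ifs at h with h4
    · exact ⟨h4, hφ0 _ h⟩
    · exact absurd rfl h
  have hψB : ∀ y, ψ y ≠ 0 → y ∈ B := by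
    intro y hy
    obtain ⟨h4, hG⟩ := hψne y hy
    exact ⟨fun j => (FriendsH2.half_lt_holeTerm_of_levelFun_lt_two (hpos4 y h4) (by linarith) j).le, hG.le⟩
  have hBc : IsClosed B :=
    (continuousOn_levelFun (by norm_num : (0 : ℝ) < 1 / 2)).preimage_isClosed_of_isClosed
      (isClosed_guard (1 / 2)) isClosed_Iic
  refine ⟨ψ, B, ?_, fun x hx => ?_, hBc, hmN, hψB, fun v hv x => ?_⟩
  · rw [contDiff_iff_contDiffAt]
    intro y
    by_cases hy4 : ∀ j : Fin k, (1 : ℝ) / 4 < holeTerm k j y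
    · have hy0 : ∀ j, holeTerm k j y ≠ 0 := fun j => (hpos4 y hy4 j).ne'
      have hev : ψ =ᶠ[𝓝 y] fun y' => φ (levelFun k y') := by
        filter_upwards [(isOpen_guard (1 / 4)).mem_nhds hy4] with y' hy'
        simp only [hψ, if_pos hy']
      exact (hφs.contDiffAt.comp y (contDiffAt_levelFun hy0)).congr_of_eventuallyEq hev
    · push Not at hy4
      obtain ⟨j, hj⟩ := hy4
      have hev : ψ =ᶠ[𝓝 y] fun _ => 0 := by
        have hopen : IsOpen {y' : EuclideanSpace ℝ (Fin 4) | holeTerm k j y' < 1 / 2} :=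
          isOpen_lt (continuous_holeTerm j) continuous_const
        filter_upwards [hopen.mem_nhds (show holeTerm k j y < 1 / 2 by linarith)] with y' hy'
        by_contra h
        have := (hψB y' h).1 j
        linarith
      exact (contDiffAt_const (c := (0 : ℝ))).congr_of_eventuallyEq hev
  · have h4 : ∀ j : Fin k, (1 : ℝ) / 4 < holeTerm k j x := fun j => by linarith [hx.1 j]
    simp only [hψ, if_pos h4]
    exact hφ1 _ (by linarith [hx.2])
  · have hT : ∀ j, holeTerm k j (fibreRot (fun _ => v) x) = holeTerm k j x := fun j =>
      holeTerm_fibreRot _ j x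
    have hG : levelFun k (fibreRot (fun _ => v) x) = levelFun k x := levelFun_fibreRot (by simpa using hv)
    simp only [hψ, hT, hG]

/-! ## Phase rotations by invariant angle functions -/

/-- **The fibre rotation by an invariant smooth angle function is a smooth injective immersion**: for
`ϑ : ℝ⁴ → ℝ` smooth and invariant under the rotations of the `w`-plane, `x ↦ (z, w e^{iϑ(x)})` is smooth
with the smooth left inverse `y ↦ (z, w e^{-iϑ(y)})` (by invariance). [folklore] -/
theorem phaseRot_embedding {ϑ : EuclideanSpace ℝ (Fin 4) → ℝ} (hϑ : ContDiff ℝ ∞ ϑ)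
    (hinv : ∀ v : ℂ, ‖v‖ = 1 → ∀ x, ϑ (fibreRot (fun _ => v) x) = ϑ x) :
    ContDiff ℝ ∞ (fun x => fibreRot (fun _ => Complex.exp ((ϑ x : ℂ) * Complex.I)) x) ∧
    Injective (fun x => fibreRot (fun _ => Complex.exp ((ϑ x : ℂ) * Complex.I)) x) ∧
    ∀ x, Injective (fderiv ℝ (fun x => fibreRot (fun _ => Complex.exp ((ϑ x : ℂ) * Complex.I)) x) x) := by
  have hunit : ∀ s : ℝ, ‖Complex.exp ((s : ℂ) * Complex.I)‖ = 1 := fun s => by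
    rw [Complex.norm_exp_ofReal_mul_I]
  have hsm : ∀ {η : EuclideanSpace ℝ (Fin 4) → ℝ}, ContDiff ℝ ∞ η →
      ContDiff ℝ ∞ (fun x => fibreRot (fun _ => Complex.exp ((η x : ℂ) * Complex.I)) x) := by
    intro η hη
    rw [contDiff_iff_contDiffAt]
    intro x
    simp only [fibreRot]
    refine contDiff_zC.contDiffAt.ofZW (contDiff_wC.contDiffAt.mul ?_)
    exact (Complex.contDiff_exp.contDiffAt).comp x
      (((Complex.ofRealCLM.contDiff.comp hη).mul contDiff_const).contDiffAt)
  set F := fun x => fibreRot (fun _ => Complex.exp ((ϑ x : ℂ) * Complex.I)) x with hF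
  set Finv := fun x => fibreRot (fun _ => Complex.exp (((-ϑ x : ℝ) : ℂ) * Complex.I)) x with hFinv
  have hleft : ∀ x, Finv (F x) = x := by
    intro x
    have hϑ' : ϑ (fibreRot (fun _ => Complex.exp ((ϑ x : ℂ) * Complex.I)) x) = ϑ x :=
      hinv _ (hunit _) x
    simp only [hFinv, hF, fibreRot_fibreRot]
    refine fibreRot_of_apply_eq_one ?_
    rw [← Complex.exp_add, hϑ']
    push_cast
    rw [neg_mul, add_neg_cancel, Complex.exp_zero]
  have hFs : ContDiff ℝ ∞ F := hsm hϑ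
  have hFinvs : ContDiff ℝ ∞ Finv := hsm hϑ.neg
  refine ⟨hFs, (LeftInverse.injective hleft), fun x => ?_⟩
  have hcomp : Finv ∘ F = id := funext hleft
  have hchain := fderiv_comp x (hFinvs.differentiable (by simp) _) (hFs.differentiable (by simp) x)
  rw [hcomp, fderiv_id] at hchain
  refine Function.LeftInverse.injective (g := fderiv ℝ Finv (F x)) fun v => ?_
  have := congrArg (fun L : EuclideanSpace ℝ (Fin 4) →L[ℝ] EuclideanSpace ℝ (Fin 4) => L v) hchain
  simpa using this.symm

/-- A smooth injective immersion of `ℝ⁴` followed by a diffeomorphism is a smooth injective immersion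
(chain rule). [folklore] -/
theorem diffeomorph_comp_embedding (κ : EuclideanSpace ℝ (Fin 4) ≃ₘ⟮𝓡 4, 𝓡 4⟯ EuclideanSpace ℝ (Fin 4))
    {F : EuclideanSpace ℝ (Fin 4) → EuclideanSpace ℝ (Fin 4)} (hFs : ContDiff ℝ ∞ F)
    (hFi : Injective F) (hFd : ∀ x, Injective (fderiv ℝ F x)) :
    ContDiff ℝ ∞ (κ ∘ F) ∧ Injective (κ ∘ F) ∧ ∀ x, Injective (fderiv ℝ (κ ∘ F) x) := by
  have hκs : ContDiff ℝ ∞ (κ : EuclideanSpace ℝ (Fin 4) → EuclideanSpace ℝ (Fin 4)) := contMDiff_iff_contDiff.1 κ.contMDiff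
  have hκ's : ContDiff ℝ ∞ (κ.symm : EuclideanSpace ℝ (Fin 4) → EuclideanSpace ℝ (Fin 4)) := contMDiff_iff_contDiff.1 κ.symm.contMDiff
  refine ⟨hκs.comp hFs, κ.injective.comp hFi, fun x => ?_⟩
  rw [fderiv_comp x (hκs.differentiable (by simp) _) (hFs.differentiable (by simp) x),
    ContinuousLinearMap.coe_comp]
  refine Injective.comp ?_ (hFd x)
  have hcomp : (κ.symm : EuclideanSpace ℝ (Fin 4) → EuclideanSpace ℝ (Fin 4)) ∘ κ = id := by
    funext y; simp
  have hchain := fderiv_comp (F x) (hκ's.differentiable (by simp) _) (hκs.differentiable (by simp) (F x))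
  rw [hcomp, fderiv_id] at hchain
  refine Function.LeftInverse.injective (g := fderiv ℝ κ.symm (κ (F x))) fun v => ?_
  have := congrArg (fun L : EuclideanSpace ℝ (Fin 4) →L[ℝ] EuclideanSpace ℝ (Fin 4) => L v) hchain
  simpa using this.symm


/-! ## The assembly: the dynamic clause of M3 from phase data and an equivariant squeeze -/

/-- Unit vectors `v/|v|` of nonzero complex numbers have norm `1`. [folklore] -/
theorem norm_unit_eq_one {v : ℂ} (hv : v ≠ 0) : ‖v / ((‖v‖ : ℝ) : ℂ)‖ = 1 := by
  rw [norm_div, Complex.norm_real, Real.norm_eq_abs, abs_of_nonneg (norm_nonneg _), div_self (norm_ne_zero_iff.2 hv)]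

/-- The twist multiplier `u_ε(z) = Π_l u(z - c_l)^{ε_l}` is a unit off the hole centres. [folklore] -/
theorem norm_twistProd_eq_one {k : ℕ} (ε : Fin k → ℤ) {z : ℂ} (hz : ∀ l : Fin k, z ≠ holeCentre k l) :
    ‖∏ l : Fin k, ((z - holeCentre k l) / (((‖z - holeCentre k l‖ : ℝ)) : ℂ)) ^ (ε l)‖ = 1 := by
  rw [norm_prod]
  refine Finset.prod_eq_one fun l _ => ?_
  rw [norm_zpow, norm_unit_eq_one (sub_ne_zero.2 (hz l)), one_zpow]

/-- **The dynamic clause of the model lemma M3 from its analytic ingredients** (see the module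
docstring): given the static data, equivariance of the charts, phase data `ε, Θ` for `m, ρ` and an
equivariant squeeze `κ` with swept-angle lifts `SW_l` for `U, ρ`, the map
`θ = κ ∘ ((z, w) ↦ (z, w e^{iϑ}))`, `ϑ` an invariant cutoff of `Θ ∘ κ + Σ_l ε_l SW_l`, is a smooth
injective immersion of `ℝ⁴` with `θ ∘ τ^ε = κ` where `κ` lands in the ball and
`θ ∘ τ^ε = h j ∘ R_{m j} ∘ (h j)⁻¹ ∘ κ` where it lands in tube `j`. [folklore] -/
theorem modelHandles_dynamic_of_data (k : ℕ) (c : EuclideanSpace ℝ (Fin 4)) (a : ℝ)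
    (W : Set (EuclideanSpace ℝ (Fin 4))) (h : Fin k → EuclideanSpace ℝ (Fin 4) → EuclideanSpace ℝ (Fin 4))
    (hcD : closedBall c (3 * a / 2) ⊆ modelHandlebody k)
    (hTW : {p : EuclideanSpace ℝ (Fin 4) | |p 0| ≤ 1 ∧ (p 1) ^ 2 + (p 2) ^ 2 + (p 3) ^ 2 ≤ 1} ⊆ W)
    (hhD : ∀ j, MapsTo (h j) W (modelHandlebody k))
    (hequiv : ∀ j (β : ℝ), ∀ p ∈ W, h j (!₂[p 0, p 1, Real.cos β * p 2 - Real.sin β * p 3,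
      Real.sin β * p 2 + Real.cos β * p 3]) = fibreRot (fun _ => Complex.exp ((β : ℂ) * Complex.I)) (h j p))
    (hphase : ∀ (m : Fin k → ℤ) (ρ : ℝ), ρ < 3 * a / 2 → ∃ (ε : Fin k → ℤ) (N' : Set (EuclideanSpace ℝ (Fin 4)))
      (Θ : EuclideanSpace ℝ (Fin 4) → ℝ), IsOpen N' ∧ closedBall c ρ ⊆ N' ∧
      (∀ j, h j '' {p : EuclideanSpace ℝ (Fin 4) | |p 0| ≤ 1 ∧ (p 1) ^ 2 + (p 2) ^ 2 + (p 3) ^ 2 ≤ 1} ⊆ N') ∧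
      ContDiffOn ℝ ∞ Θ N' ∧ (∀ v : ℂ, ‖v‖ = 1 → ∀ y ∈ N', Θ (fibreRot (fun _ => v) y) = Θ y) ∧
      (∀ y ∈ N', dist y c ≤ ρ → Complex.exp ((Θ y : ℂ) * Complex.I) *
        ∏ l : Fin k, ((zC y - holeCentre k l) / (((‖zC y - holeCentre k l‖ : ℝ)) : ℂ)) ^ (ε l) = 1) ∧
      (∀ j, ∀ p ∈ W, h j p ∈ N' → Complex.exp ((Θ (h j p) : ℂ) * Complex.I) *
        ∏ l : Fin k, ((zC (h j p) - holeCentre k l) / (((‖zC (h j p) - holeCentre k l‖ : ℝ)) : ℂ)) ^ (ε l) =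
        Complex.exp (((2 * Real.pi * (m j : ℝ) * Real.smoothTransition (p 0 + 1 / 2) : ℝ) : ℂ) * Complex.I)))
    (hsqueeze : ∀ (U : Set (EuclideanSpace ℝ (Fin 4))) (ρ : ℝ), IsOpen U → modelHandlebody k ⊆ U →
      a < ρ → ρ < 3 * a / 2 → ∃ (κ : EuclideanSpace ℝ (Fin 4) ≃ₘ⟮𝓡 4, 𝓡 4⟯ EuclideanSpace ℝ (Fin 4))
      (K N₀ : Set (EuclideanSpace ℝ (Fin 4))) (SW : Fin k → EuclideanSpace ℝ (Fin 4) → ℝ),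
      IsCompact K ∧ K ⊆ U ∧ (∀ x, x ∉ K → κ x = x) ∧
      (∀ v : ℂ, ‖v‖ = 1 → ∀ x, κ (fibreRot (fun _ => v) x) = fibreRot (fun _ => v) (κ x)) ∧
      (∀ x ∈ modelHandlebody k, κ x ∈ closedBall c ρ ∨ ∃ j, ∃ p ∈ {p : EuclideanSpace ℝ (Fin 4) |
        |p 0| ≤ 1 ∧ (p 1) ^ 2 + (p 2) ^ 2 + (p 3) ^ 2 ≤ 1}, κ x = h j p) ∧
      IsOpen N₀ ∧ modelHandlebody k ⊆ N₀ ∧ (∀ l, ContDiffOn ℝ ∞ (SW l) N₀) ∧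
      (∀ l (v : ℂ), ‖v‖ = 1 → ∀ x, SW l (fibreRot (fun _ => v) x) = SW l x) ∧
      ∀ l, ∀ x ∈ modelHandlebody k,
        (zC (κ x) - holeCentre k l) / ((‖zC (κ x) - holeCentre k l‖ : ℝ) : ℂ) =
          Complex.exp ((SW l x : ℂ) * Complex.I) * ((zC x - holeCentre k l) / ((‖zC x - holeCentre k l‖ : ℝ) : ℂ))) :
    ∀ (U : Set (EuclideanSpace ℝ (Fin 4))) (m : Fin k → ℤ) (ρ : ℝ), IsOpen U → modelHandlebody k ⊆ U →
      a < ρ → ρ < 3 * a / 2 → ∃ (ε : Fin k → ℤ) (κ : EuclideanSpace ℝ (Fin 4) ≃ₘ⟮𝓡 4, 𝓡 4⟯ EuclideanSpace ℝ (Fin 4))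
      (K : Set (EuclideanSpace ℝ (Fin 4))) (θ : EuclideanSpace ℝ (Fin 4) → EuclideanSpace ℝ (Fin 4)),
      IsCompact K ∧ K ⊆ U ∧ (∀ x, x ∉ K → κ x = x) ∧ ContDiff ℝ ∞ θ ∧ Injective θ ∧
      (∀ x, Injective (fderiv ℝ θ x)) ∧ ∀ x ∈ modelHandlebody k,
        (κ x ∈ closedBall c ρ ∧ θ (fibreRot (fun z : ℂ => ∏ l : Fin k,
          ((z - holeCentre k l) / (((‖z - holeCentre k l‖ : ℝ)) : ℂ)) ^ (ε l)) x) = κ x) ∨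
        (∃ j, ∃ p ∈ {p : EuclideanSpace ℝ (Fin 4) | |p 0| ≤ 1 ∧ (p 1) ^ 2 + (p 2) ^ 2 + (p 3) ^ 2 ≤ 1},
          κ x = h j p ∧ θ (fibreRot (fun z : ℂ => ∏ l : Fin k,
            ((z - holeCentre k l) / (((‖z - holeCentre k l‖ : ℝ)) : ℂ)) ^ (ε l)) x) =
            h j (!₂[p 0, p 1, Real.cos (2 * Real.pi * (m j : ℝ) * Real.smoothTransition (p 0 + 1 / 2)) * p 2 -
              Real.sin (2 * Real.pi * (m j : ℝ) * Real.smoothTransition (p 0 + 1 / 2)) * p 3,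
              Real.sin (2 * Real.pi * (m j : ℝ) * Real.smoothTransition (p 0 + 1 / 2)) * p 2 +
              Real.cos (2 * Real.pi * (m j : ℝ) * Real.smoothTransition (p 0 + 1 / 2)) * p 3])) := by
  intro U m ρ hUo hDU haρ hρ
  set T : Set (EuclideanSpace ℝ (Fin 4)) :=
    {p : EuclideanSpace ℝ (Fin 4) | |p 0| ≤ 1 ∧ (p 1) ^ 2 + (p 2) ^ 2 + (p 3) ^ 2 ≤ 1} with hT
  obtain ⟨ε, N', Θ, hN'o, hballN', htubeN', hΘs, hΘinv, hΘball, hΘtube⟩ := hphase m ρ hρ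
  obtain ⟨κ, K, N₀, SW, hKc, hKU, hκK, hκrot, hκimg, hN₀o, hDN₀, hSWs, hSWinv, hSWid⟩ :=
    hsqueeze U ρ hUo hDU haρ hρ
  set uε : ℂ → ℂ := fun z => ∏ l : Fin k, ((z - holeCentre k l) / (((‖z - holeCentre k l‖ : ℝ)) : ℂ)) ^ (ε l)
    with huε
  -- where `κ` takes `D_k`
  have hρ' : closedBall c ρ ⊆ modelHandlebody k := (closedBall_subset_closedBall hρ.le).trans hcD
  have hκD : ∀ x ∈ modelHandlebody k, κ x ∈ modelHandlebody k ∧ κ x ∈ N' := by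
    intro x hx
    rcases hκimg x hx with hb | ⟨j, p, hp, hjp⟩
    · exact ⟨hρ' hb, hballN' hb⟩
    · rw [hjp]; exact ⟨hhD j (hTW hp), htubeN' j ⟨p, hp, rfl⟩⟩
  have hzD : ∀ y ∈ modelHandlebody k, ∀ l : Fin k, zC y ≠ holeCentre k l := fun y hy l =>
    zC_ne_holeCentre hy.1 l
  -- the raw angle function near `D_k`
  set N₁ : Set (EuclideanSpace ℝ (Fin 4)) := κ ⁻¹' N' ∩ N₀ with hN₁
  have hN₁o : IsOpen N₁ := (hN'o.preimage κ.continuous).inter hN₀o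
  have hDN₁ : modelHandlebody k ⊆ N₁ := fun x hx => ⟨(hκD x hx).2, hDN₀ hx⟩
  set ϑ : EuclideanSpace ℝ (Fin 4) → ℝ := fun x => Θ (κ x) + ∑ l : Fin k, (ε l : ℝ) * SW l x with hϑ
  have hκs : ContDiff ℝ ∞ (κ : EuclideanSpace ℝ (Fin 4) → EuclideanSpace ℝ (Fin 4)) :=
    contMDiff_iff_contDiff.1 κ.contMDiff
  have hϑs : ∀ x ∈ N₁, ContDiffAt ℝ ∞ ϑ x := by
    intro x hx
    refine ContDiffAt.add ?_ (ContDiffAt.sum fun l _ => contDiffAt_const.mul ?_)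
    · exact (hΘs.contDiffAt (hN'o.mem_nhds hx.1)).comp x hκs.contDiffAt
    · exact (hSWs l).contDiffAt (hN₀o.mem_nhds hx.2)
  have hϑinv : ∀ v : ℂ, ‖v‖ = 1 → ∀ x ∈ N₁, ϑ (fibreRot (fun _ => v) x) = ϑ x := by
    intro v hv x hx
    simp only [hϑ, hκrot v hv, hΘinv v hv _ hx.1, hSWinv _ v hv]
  -- the invariant cutoff and the global angle function
  obtain ⟨ψ, B, hψs, hψ1, hBc, hBN, hψB, hψinv⟩ := exists_invariant_cutoff k hN₁o hDN₁
  set ϑt : EuclideanSpace ℝ (Fin 4) → ℝ := fun x => ψ x * ϑ x with hϑt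
  have hϑts : ContDiff ℝ ∞ ϑt := by
    rw [contDiff_iff_contDiffAt]
    intro x
    by_cases hx : x ∈ N₁
    · exact hψs.contDiffAt.mul (hϑs x hx)
    · have hev : ϑt =ᶠ[𝓝 x] fun _ => 0 := by
        filter_upwards [hBc.isOpen_compl.mem_nhds (fun hB => hx (hBN hB))] with y hy
        have : ψ y = 0 := by by_contra h'; exact hy (hψB y h')
        simp only [hϑt, this, zero_mul]
      exact (contDiffAt_const (c := (0 : ℝ))).congr_of_eventuallyEq hev
  have hϑtD : ∀ x ∈ modelHandlebody k, ϑt x = ϑ x := fun x hx => by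
    simp only [hϑt, hψ1 x hx, one_mul]
  have hϑtinv : ∀ v : ℂ, ‖v‖ = 1 → ∀ x, ϑt (fibreRot (fun _ => v) x) = ϑt x := by
    intro v hv x
    simp only [hϑt, hψinv v hv]
    by_cases hψ0 : ψ x = 0
    · simp [hψ0]
    · rw [hϑinv v hv x (hBN (hψB x hψ0))]
  -- the map `θ`
  obtain ⟨hFs, hFi, hFd⟩ := phaseRot_embedding hϑts hϑtinv
  obtain ⟨hθs, hθi, hθd⟩ := diffeomorph_comp_embedding κ hFs hFi hFd
  refine ⟨ε, κ, K, κ ∘ fun x => fibreRot (fun _ => Complex.exp ((ϑt x : ℂ) * Complex.I)) x, hKc, hKU,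
    hκK, hθs, hθi, hθd, fun x hx => ?_⟩
  -- the identity on `D_k`
  have hzx := hzD x hx
  have hzκ := hzD _ (hκD x hx).1
  have hunit : ∀ l, (zC x - holeCentre k l) / ((‖zC x - holeCentre k l‖ : ℝ) : ℂ) ≠ 0 := fun l =>
    norm_ne_zero_iff.1 (by rw [norm_unit_eq_one (sub_ne_zero.2 (hzx l))]; exact one_ne_zero)
  have huεx : ‖uε (zC x)‖ = 1 := norm_twistProd_eq_one ε hzx
  have huεx0 : uε (zC x) ≠ 0 := norm_ne_zero_iff.1 (by rw [huεx]; exact one_ne_zero)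
  set P : ℂ := Complex.exp ((Θ (κ x) : ℂ) * Complex.I) * uε (zC (κ x)) with hP
  have hPn : ‖P‖ = 1 := by
    rw [hP, norm_mul, Complex.norm_exp_ofReal_mul_I, one_mul]
    exact norm_twistProd_eq_one ε hzκ
  -- `e^{iϑ(x)} = P / u_ε(z(x))`
  have hexp : uε (zC x) * Complex.exp ((ϑ x : ℂ) * Complex.I) = P := by
    have h1 : Complex.exp ((ϑ x : ℂ) * Complex.I) = Complex.exp ((Θ (κ x) : ℂ) * Complex.I) *
        ∏ l : Fin k, (Complex.exp ((SW l x : ℂ) * Complex.I)) ^ (ε l) := by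
      simp only [hϑ]
      push_cast
      rw [add_mul, Complex.exp_add, Finset.sum_mul, Complex.exp_sum]
      congr 1
      refine Finset.prod_congr rfl fun l _ => ?_
      rw [← Complex.exp_int_mul]
      ring_nf
    have h2 : ∀ l, Complex.exp ((SW l x : ℂ) * Complex.I) =
        (zC (κ x) - holeCentre k l) / ((‖zC (κ x) - holeCentre k l‖ : ℝ) : ℂ) /
          ((zC x - holeCentre k l) / ((‖zC x - holeCentre k l‖ : ℝ) : ℂ)) := fun l => by
      rw [eq_div_iff (hunit l)]
      exact (hSWid l x hx).symm
    have h3 : ∏ l : Fin k, ((zC (κ x) - holeCentre k l) / ((‖zC (κ x) - holeCentre k l‖ : ℝ) : ℂ) /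
        ((zC x - holeCentre k l) / ((‖zC x - holeCentre k l‖ : ℝ) : ℂ))) ^ (ε l) =
        uε (zC (κ x)) / uε (zC x) := by
      rw [huε, ← Finset.prod_div_distrib]
      exact Finset.prod_congr rfl fun l _ => div_zpow _ _ _
    rw [h1]
    simp_rw [h2]
    rw [h3, hP]
    field_simp
  -- `F (τ x)` is the rotation of `x` by `P`
  have hFτ : fibreRot (fun _ => Complex.exp ((ϑt (fibreRot uε x) : ℂ) * Complex.I)) (fibreRot uε x) =
      fibreRot (fun _ => P) x := by
    have hinv' : ϑt (fibreRot uε x) = ϑ x := by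
      have : fibreRot uε x = fibreRot (fun _ => uε (zC x)) x := rfl
      rw [this, hϑtinv _ huεx, hϑtD x hx]
    rw [hinv', fibreRot_fibreRot]
    show ofZW (zC x) (wC x * (uε (zC x) * Complex.exp ((ϑ x : ℂ) * Complex.I))) = ofZW (zC x) (wC x * P)
    rw [hexp]
  have hθτ : (κ ∘ fun x => fibreRot (fun _ => Complex.exp ((ϑt x : ℂ) * Complex.I)) x) (fibreRot uε x) =
      fibreRot (fun _ => P) (κ x) := by
    show κ (fibreRot (fun _ => Complex.exp ((ϑt (fibreRot uε x) : ℂ) * Complex.I)) (fibreRot uε x)) = _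
    rw [hFτ, hκrot P hPn]
  -- the two cases
  rcases hκimg x hx with hb | ⟨j, p, hp, hjp⟩
  · left
    refine ⟨hb, ?_⟩
    rw [hθτ]
    have hP1 : P = 1 := hΘball _ (hκD x hx).2 (mem_closedBall.1 hb)
    exact fibreRot_of_apply_eq_one hP1
  · right
    refine ⟨j, p, hp, hjp, ?_⟩
    rw [hθτ, hjp]
    have hPe : P = Complex.exp (((2 * Real.pi * (m j : ℝ) * Real.smoothTransition (p 0 + 1 / 2) : ℝ) : ℂ) *
        Complex.I) := by
      rw [hP, hjp]
      exact hΘtube j p (hTW hp) (hjp ▸ (hκD x hx).2)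
    rw [hPe]
    exact (hequiv j _ p (hTW hp)).symm


end ModelHandles

/-- **Registered piece `helper_handlebodyChart_modelHandles_phaseRot` of the model lemma M3 (fibre
rotations by invariant angle functions are smooth injective immersions)**: for `ϑ : ℝ⁴ → ℝ` smooth and
invariant under the rotations of the `w`-plane, `(z, w) ↦ (z, w e^{iϑ})` is smooth and injective with
injective differential (`ModelHandles.phaseRot_embedding`). [folklore] -/
theorem helper_handlebodyChart_modelHandles_phaseRot : ∀ (ϑ : EuclideanSpace ℝ (Fin 4) → ℝ), ContDiff ℝ ((⊤ : ℕ∞) : WithTop ℕ∞) ϑ → (∀ v : ℂ, ‖v‖ = 1 → ∀ x, ϑ (Literature.Topology.FourManifolds.MMSW.fibreRot (fun _ => v) x) = ϑ x) → ContDiff ℝ ((⊤ : ℕ∞) : WithTop ℕ∞) (fun x => Literature.Topology.FourManifolds.MMSW.fibreRot (fun _ => Complex.exp ((ϑ x : ℂ) * Complex.I)) x) ∧ Function.Injective (fun x => Literature.Topology.FourManifolds.MMSW.fibreRot (fun _ => Complex.exp ((ϑ x : ℂ) * Complex.I)) x) ∧ ∀ x, Function.Injective (fderiv ℝ (fun x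 => Literature.Topology.FourManifolds.MMSW.fibreRot (fun _ => Complex.exp ((ϑ x : ℂ) * Complex.I)) x) x) :=
  fun _ hϑ hinv => ModelHandles.phaseRot_embedding hϑ hinv

/-- **Registered reduction `helper_handlebodyChart_modelHandles_of_data`: the model handle lemma M3
from its analytic ingredients** (`helper_handlebodyChart_modelHandles_data`: static data of M3,
equivariance of the handle charts, phase data for every twist vector, and an equivariant squeeze with
swept-angle lifts for every neighbourhood) — by `ModelHandles.modelHandles_dynamic_of_data`. [folklore] -/
theorem helper_handlebodyChart_modelHandles_of_data : (∀ (k : ℕ), ∃ (c : EuclideanSpace ℝ (Fin 4)) (a : ℝ) (W : Set (EuclideanSpace ℝ (Fin 4))) (h : Fin k → EuclideanSpace ℝ (Fin 4) → EuclideanSpace ℝ (Fin 4)), (0 < a ∧ Metric.closedBall c (3 * a / 2) ⊆ Literature.Topology.FourManifolds.MMSW.modelHandlebody k ∧ IsOpen W ∧ {p : EuclideanSpace ℝ (Fin 4) | |p 0| ≤ 1 ∧ (p 1) ^ 2 + (p 2) ^ 2 + (p 3) ^ 2 ≤ 1} ⊆ W ∧ (∀ j, ContDiffOn ℝ ((⊤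 : ℕ∞) : WithTop ℕ∞) (h j) W ∧ Set.InjOn (h j) W ∧ (∀ p ∈ W, Function.Injective (fderiv ℝ (h j) p)) ∧ Set.MapsTo (h j) W (Literature.Topology.FourManifolds.MMSW.modelHandlebody k)) ∧ (∀ j l, j ≠ l → ∀ p ∈ W, ∀ q ∈ W, h j p ≠ h l q) ∧ (∀ j, ∀ p ∈ W, 1 / 2 ≤ |p 0| → dist (h j p) c = a * (2 - |p 0|)) ∧ (∀ j, ∀ p ∈ W, |p 0| ≤ 1 / 2 → 3 * a / 2 ≤ dist (h j p) c)) ∧ (∀ j (β : ℝ), ∀ p ∈ W, h j (!₂[p 0, p 1, Real.cos β * p 2 - Real.sin β * p 3, Real.sin β * p 2 + Real.cos β * p 3]) = Literature.Topology.FourManifolds.MMSW.fibreRot (fun _ => Complex.exp ((β : ℂ) * Complex.I)) (h j p)) ∧ (∀ (m : Fin k → ℤ) (ρ : ℝ), ρ < 3 * a / 2 → ∃ (ε : Fin k → ℤ) (N' : Set (EuclideanSpace ℝ (Fin 4))) (Θ : EuclideanSpace ℝ (Fin 4) → ℝ), IsOpen N' ∧ Metric.closedBall c ρ ⊆ N'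 ∧ (∀ j, h j '' {p : EuclideanSpace ℝ (Fin 4) | |p 0| ≤ 1 ∧ (p 1) ^ 2 + (p 2) ^ 2 + (p 3) ^ 2 ≤ 1} ⊆ N') ∧ ContDiffOn ℝ ((⊤ : ℕ∞) : WithTop ℕ∞) Θ N' ∧ (∀ v : ℂ, ‖v‖ = 1 → ∀ y ∈ N', Θ (Literature.Topology.FourManifolds.MMSW.fibreRot (fun _ => v) y) = Θ y) ∧ (∀ y ∈ N', dist y c ≤ ρ → Complex.exp ((Θ y : ℂ) * Complex.I) * ∏ l : Fin k, ((Literature.AlgebraicTopology.Homotopy.HopfFibration.zC y - Literature.Topology.FourManifolds.MMSW.holeCentre k l) / (((‖Literature.AlgebraicTopology.Homotopy.HopfFibration.zC y - Literature.Topology.FourManifolds.MMSW.holeCentre k l‖ : ℝ)) : ℂ)) ^ (ε l) = 1) ∧ (∀ j, ∀ p ∈ W, h j p ∈ N' → Complex.exp ((Θ (h j p) : ℂ) * Complex.I) * ∏ l : Fin k, ((Literature.AlgebraicTopology.Homotopy.HopfFibration.zC (h j p) - Literature.Topology.FourManifolds.MMSW.holeCentre k l) / (((‖Literature.AlgebraicTopology.Homotopy.HopfFibration.zC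 (h j p) - Literature.Topology.FourManifolds.MMSW.holeCentre k l‖ : ℝ)) : ℂ)) ^ (ε l) = Complex.exp (((2 * Real.pi * (m j : ℝ) * Real.smoothTransition (p 0 + 1 / 2) : ℝ) : ℂ) * Complex.I))) ∧ (∀ (U : Set (EuclideanSpace ℝ (Fin 4))) (ρ : ℝ), IsOpen U → Literature.Topology.FourManifolds.MMSW.modelHandlebody k ⊆ U → a < ρ → ρ < 3 * a / 2 → ∃ (κ : EuclideanSpace ℝ (Fin 4) ≃ₘ⟮𝓡 4, 𝓡 4⟯ EuclideanSpace ℝ (Fin 4)) (K N₀ : Set (EuclideanSpace ℝ (Fin 4))) (SW : Fin k → EuclideanSpace ℝ (Fin 4) → ℝ), IsCompact K ∧ K ⊆ U ∧ (∀ x, x ∉ K → κ x = x) ∧ (∀ v : ℂ, ‖v‖ = 1 → ∀ x, κ (Literature.Topology.FourManifolds.MMSW.fibreRot (fun _ => v) x) = Literature.Topology.FourManifolds.MMSW.fibreRot (fun _ => v) (κ x)) ∧ (∀ x ∈ Literature.Topology.FourManifolds.MMSW.modelHandlebody k, κ x ∈ Metric.closedBall c ρ ∨ ∃ j, ∃ p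 ∈ {p : EuclideanSpace ℝ (Fin 4) | |p 0| ≤ 1 ∧ (p 1) ^ 2 + (p 2) ^ 2 + (p 3) ^ 2 ≤ 1}, κ x = h j p) ∧ IsOpen N₀ ∧ Literature.Topology.FourManifolds.MMSW.modelHandlebody k ⊆ N₀ ∧ (∀ l, ContDiffOn ℝ ((⊤ : ℕ∞) : WithTop ℕ∞) (SW l) N₀) ∧ (∀ l (v : ℂ), ‖v‖ = 1 → ∀ x, SW l (Literature.Topology.FourManifolds.MMSW.fibreRot (fun _ => v) x) = SW l x) ∧ ∀ l, ∀ x ∈ Literature.Topology.FourManifolds.MMSW.modelHandlebody k, (Literature.AlgebraicTopology.Homotopy.HopfFibration.zC (κ x) - Literature.Topology.FourManifolds.MMSW.holeCentre k l) / ((‖Literature.AlgebraicTopology.Homotopy.HopfFibration.zC (κ x) - Literature.Topology.FourManifolds.MMSW.holeCentre k l‖ : ℝ) : ℂ) = Complex.exp ((SW l x : ℂ) * Complex.I) * ((Literature.AlgebraicTopology.Homotopy.HopfFibration.zC x - Literature.Topology.FourManifolds.MMSW.holeCentre k l) / ((‖Literature.AlgebraicTopology.Homotopy.HopfFibration.zC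 x - Literature.Topology.FourManifolds.MMSW.holeCentre k l‖ : ℝ) : ℂ)))) → ∀ (k : ℕ), ∃ (c : EuclideanSpace ℝ (Fin 4)) (a : ℝ) (W : Set (EuclideanSpace ℝ (Fin 4))) (h : Fin k → EuclideanSpace ℝ (Fin 4) → EuclideanSpace ℝ (Fin 4)), 0 < a ∧ Metric.closedBall c (3 * a / 2) ⊆ Literature.Topology.FourManifolds.MMSW.modelHandlebody k ∧ IsOpen W ∧ {p : EuclideanSpace ℝ (Fin 4) | |p 0| ≤ 1 ∧ (p 1) ^ 2 + (p 2) ^ 2 + (p 3) ^ 2 ≤ 1} ⊆ W ∧ (∀ j, ContDiffOn ℝ ((⊤ : ℕ∞) : WithTop ℕ∞) (h j) W ∧ Set.InjOn (h j) W ∧ (∀ p ∈ W, Function.Injective (fderiv ℝ (h j) p)) ∧ Set.MapsTo (h j) W (Literature.Topology.FourManifolds.MMSW.modelHandlebody k)) ∧ (∀ j l, j ≠ l → ∀ p ∈ W, ∀ q ∈ W, h j p ≠ h l q) ∧ (∀ j, ∀ p ∈ W, 1 / 2 ≤ |p 0| → dist (h j p) c = a * (2 - |p 0|)) ∧ (∀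 j, ∀ p ∈ W, |p 0| ≤ 1 / 2 → 3 * a / 2 ≤ dist (h j p) c) ∧ ∀ (U : Set (EuclideanSpace ℝ (Fin 4))) (m : Fin k → ℤ) (ρ : ℝ), IsOpen U → Literature.Topology.FourManifolds.MMSW.modelHandlebody k ⊆ U → a < ρ → ρ < 3 * a / 2 → ∃ (ε : Fin k → ℤ) (κ : EuclideanSpace ℝ (Fin 4) ≃ₘ⟮𝓡 4, 𝓡 4⟯ EuclideanSpace ℝ (Fin 4)) (K : Set (EuclideanSpace ℝ (Fin 4))) (θ : EuclideanSpace ℝ (Fin 4) → EuclideanSpace ℝ (Fin 4)), IsCompact K ∧ K ⊆ U ∧ (∀ x, x ∉ K → κ x = x) ∧ ContDiff ℝ ((⊤ : ℕ∞) : WithTop ℕ∞) θ ∧ Function.Injective θ ∧ (∀ x, Function.Injective (fderiv ℝ θ x)) ∧ ∀ x ∈ Literature.Topology.FourManifolds.MMSW.modelHandlebody k, (κ x ∈ Metric.closedBall c ρ ∧ θ (Literature.Topology.FourManifolds.MMSW.fibreRot (fun z : ℂ => ∏ l : Fin k, ((z - Literature.Topology.FourManifolds.MMSW.holeCentre k l)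 / (((‖z - Literature.Topology.FourManifolds.MMSW.holeCentre k l‖ : ℝ)) : ℂ)) ^ (ε l)) x) = κ x) ∨ (∃ j, ∃ p ∈ {p : EuclideanSpace ℝ (Fin 4) | |p 0| ≤ 1 ∧ (p 1) ^ 2 + (p 2) ^ 2 + (p 3) ^ 2 ≤ 1}, κ x = h j p ∧ θ (Literature.Topology.FourManifolds.MMSW.fibreRot (fun z : ℂ => ∏ l : Fin k, ((z - Literature.Topology.FourManifolds.MMSW.holeCentre k l) / (((‖z - Literature.Topology.FourManifolds.MMSW.holeCentre k l‖ : ℝ)) : ℂ)) ^ (ε l)) x) = h j (!₂[p 0, p 1, Real.cos (2 * Real.pi * (m j : ℝ) * Real.smoothTransition (p 0 + 1 / 2)) * p 2 - Real.sin (2 * Real.pi * (m j : ℝ) * Real.smoothTransition (p 0 + 1 / 2)) * p 3, Real.sin (2 * Real.pi * (m j : ℝ) * Real.smoothTransition (p 0 + 1 / 2)) * p 2 + Real.cos (2 * Real.pi * (m j : ℝ) * Real.smoothTransition (p 0 + 1 / 2)) * p 3])) := by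
  intro hdata k
  obtain ⟨c, a, W, h, ⟨ha, hcD, hWo, hTW, hh, hdisj, hnear, hfar⟩, hequiv, hphase, hsqueeze⟩ := hdata k
  exact ⟨c, a, W, h, ha, hcD, hWo, hTW, hh, hdisj, hnear, hfar,
    ModelHandles.modelHandles_dynamic_of_data k c a W h hcD hTW (fun j => (hh j).2.2.2) hequiv hphase
      hsqueeze⟩

end Summit.SmoothPoincare4.SmoothPoincare4.Theorems.DcrGap.MkFriends

end
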